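import Literature.AnabelianGeometry.SemiGraphs.TemperedAnabelianThm68Sub

/-!
# [SemiAnbd] Thm. 6.8 sub-DAG: two rows PROVED — essential surjectivity from "objects hit on the nose" (T68i-L03 ⇐ L02) and the transport of the `[n]`-subgroups (T68iii-L06)

Mochizuki, *Semi-graphs of anabelioids* [SemiAnbd], §6 Thm. 6.8 (i)/(iii), kurims pp. 74–75; the
steps are [Mzk8] (*Galois sections in absolute anabelian geometry*) Thm. 2.3 (i) — object half of
"follows formally from Theorem 1.2" — and the transport step of the proof of Cor. 2.6, p. 10 ("by
transporting `φ`, `ψ` via the equivalences of Theorem 2.3, (i), and applying Theorem 1.3, (ii),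
(iii)"). [cite: MochizukiSemiAnbd2006, Thm 6.8 pp.74-75] [cite: MochizukiGalSect2005, §2 pp.9-10]

Proof-only companion (abc-iut cell, layer L3, seat abc-iut-w5-d040) to the statements file
`TemperedAnabelianThm68Sub.lean`:
* `Thm68Sub.piFunctorEssSurj_of_onTheNose : ObjectsHitOnTheNose X D → PiFunctorEssSurj X D` — two
  group-theoretic objects with the same `(H, N)` are isomorphic in `DLocObj.dlocCategory X` through
  the identity of `J = H/N` (`jEquivOfEq`, over `G_K`);
* `Thm68Sub.mulNSubgroupTransport_holds : MulNSubgroupTransport X Y α` — pure group theory over the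
  FROZEN interface `TemperedCurve`: openness/finite index along the homeomorphism `α`, condition (i)
  by [SemiAnbd] Thm. 6.5 (iii) as typed (`TemperedCurve.IsoPreservesCuspidalDecomp`), condition (ii)
  by naturality of `Abelianization` along `Δ^temp_X ⥲ Δ^temp_Y`.
Nothing of [SemiAnbd]/[Mzk8] is asserted; nothing here takes a side on [IUTchIII] Cor. 3.12.
-/

noncomputable section

namespace Literature.AnabelianGeometry.SemiGraphs

open scoped Pointwise
open CategoryTheory Topology

variable {p : ℕ} [Fact p.Prime]

namespace Thm68Sub

/-! ### T68i-L03 ⇐ T68i-L02: essential surjectivity from "objects hit on the nose" -/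

section EssSurj

variable {X : TemperedCurve p}

/-- Two group-theoretic objects of `DLoc_{G_K}(Π^temp_{X_K})` with the same open subgroup `H` and the
same kernel `N` have isomorphic `J = H/N` (the identity map), as topological groups.
[cite: MochizukiSemiAnbd2006, §6 p.74] -/
private def jEquivOfEq (A B : DLocObj X) (hH : A.H = B.H) (hN : A.N = B.N) : A.J ≃ₜ* B.J :=
  haveI := A.normal_subgroupOf_N
  haveI := B.normal_subgroupOf_N
  have hmap : A.NH.map (MulEquiv.subgroupCongr hH).toMonoidHom = B.NH := by
    rw [A.NH_eq, B.NH_eq]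
    ext ⟨y, hy⟩
    constructor
    · rintro ⟨⟨x, hx⟩, hxN, hxy⟩
      have : x = y := by simpa using congrArg Subtype.val hxy
      subst this
      exact Subgroup.mem_subgroupOf.2 (hN ▸ (Subgroup.mem_subgroupOf.1 hxN))
    · intro hyN
      refine ⟨⟨y, hH ▸ hy⟩, Subgroup.mem_subgroupOf.2 (hN.symm ▸ Subgroup.mem_subgroupOf.1 hyN), ?_⟩
      ext; rfl
  { QuotientGroup.congr A.NH B.NH (MulEquiv.subgroupCongr hH) hmap with
    continuous_toFun := by
      apply (QuotientGroup.isQuotientMap_mk A.NH).continuous_iff.2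
      change Continuous (fun h : A.H => (QuotientGroup.mk (MulEquiv.subgroupCongr hH h) : B.J))
      exact QuotientGroup.continuous_mk.comp
        (Continuous.subtype_mk continuous_subtype_val _)
    continuous_invFun := by
      apply (QuotientGroup.isQuotientMap_mk B.NH).continuous_iff.2
      change Continuous (fun h : B.H => (QuotientGroup.mk ((MulEquiv.subgroupCongr hH).symm h) : A.J))
      exact QuotientGroup.continuous_mk.comp
        (Continuous.subtype_mk continuous_subtype_val _) }

/-- `jEquivOfEq` on classes. [cite: MochizukiSemiAnbd2006, §6 p.74] -/
private theorem jEquivOfEq_mk (A B : DLocObj X) (hH : A.H = B.H) (hN : A.N = B.N) (h : A.H) :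
    jEquivOfEq A B hH hN (A.proj h) = B.proj (MulEquiv.subgroupCongr hH h) := rfl

/-- `jEquivOfEq` lies over `G_K`. [cite: MochizukiSemiAnbd2006, §6 p.74] -/
private theorem augJ_jEquivOfEq (A B : DLocObj X) (hH : A.H = B.H) (hN : A.N = B.N) (j : A.J) :
    B.augJ (jEquivOfEq A B hH hN j) = A.augJ j := by
  obtain ⟨h, rfl⟩ := QuotientGroup.mk_surjective j
  change B.augJ (jEquivOfEq A B hH hN (A.proj h)) = A.augJ (A.proj h)
  rw [jEquivOfEq_mk, DLocObj.augJ_proj, DLocObj.augJ_proj]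
  rfl

/-- **T68i-L03 ⇐ T68i-L02 (PROVED)**: if every group-theoretic object `(H, N)` is hit on the nose by
the tempered fundamental group functor, the functor is essentially surjective ([Mzk8] Thm. 2.3 (i),
object half; [SemiAnbd] Thm. 6.8 (i)). [cite: MochizukiSemiAnbd2006, Thm 6.8(i) p.74] -/
theorem piFunctorEssSurj_of_onTheNose (D : DLocSchemeData X) (h : ObjectsHitOnTheNose X D) :
    PiFunctorEssSurj X D := by
  letI := D.catK; letI := DLocObj.dlocCategory X
  refine ⟨fun A => ?_⟩
  obtain ⟨Z, hH, hN⟩ := h A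
  exact ⟨Z, ⟨DLocObj.isoOfEquiv (jEquivOfEq _ _ hH hN) (augJ_jEquivOfEq _ _ hH hN)⟩⟩

end EssSurj

end Thm68Sub


namespace Thm68Sub

variable {X Y : TemperedCurve p} (α : X.PiTemp ≃ₜ* Y.PiTemp)

/-- The restriction of `α` to the geometric subgroups, as an isomorphism `Δ^temp_X ⥲ Δ^temp_Y`, when
`α(Δ^temp_X) = Δ^temp_Y`. [cite: MochizukiSemiAnbd2006, Thm 6.8(iii) p.75] -/
private def deltaEquiv (hΔ : X.DeltaTemp.map α.toMulEquiv.toMonoidHom = Y.DeltaTemp) :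
    X.DeltaTemp ≃* Y.DeltaTemp :=
  (α.toMulEquiv.subgroupMap X.DeltaTemp).trans (MulEquiv.subgroupCongr hΔ)

/-- `deltaEquiv` is `α` on underlying elements. [cite: MochizukiSemiAnbd2006, Thm 6.8(iii) p.75] -/
@[simp] private theorem coe_deltaEquiv (hΔ : X.DeltaTemp.map α.toMulEquiv.toMonoidHom = Y.DeltaTemp)
    (δ : X.DeltaTemp) : ((deltaEquiv α hΔ δ : Y.DeltaTemp) : Y.PiTemp) = α (δ : X.PiTemp) := rfl

/-- Membership in the subgroup of `n`-th powers of the abelianization is transported along an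
isomorphism of groups (naturality of `Abelianization`). [folklore] -/
private theorem of_mem_range_pow_iff {G H : Type*} [Group G] [Group H] (e : G ≃* H) (n : ℕ) (g : G) :
    Abelianization.of g ∈ (powMonoidHom n : Abelianization G →* Abelianization G).range ↔
      Abelianization.of (e g) ∈ (powMonoidHom n : Abelianization H →* Abelianization H).range := by
  constructor
  · rintro ⟨a, ha⟩
    refine ⟨e.abelianizationCongr a, ?_⟩
    rw [powMonoidHom_apply, ← map_pow, ← powMonoidHom_apply, ha, abelianizationCongr_of]
  · rintro ⟨b, hb⟩
    refine ⟨e.abelianizationCongr.symm b, ?_⟩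
    apply e.abelianizationCongr.injective
    rw [powMonoidHom_apply, map_pow, MulEquiv.apply_symm_apply, ← powMonoidHom_apply, hb,
      abelianizationCongr_of]

/-- **T68iii-L06 PROVED**: `Thm68Sub.MulNSubgroupTransport X Y α` — an isomorphism of tempered
groups preserving `Δ^temp` and cuspidal decomposition groups ([SemiAnbd] Thm. 6.5 (iii), typed as
`TemperedCurve.IsoPreservesCuspidalDecomp`) carries multiplication-by-`n` subgroups of `Π^temp_{X_K}`
to multiplication-by-`n` subgroups of `Π^temp_{Y_L}` ([Mzk8] proof of Cor. 2.6, transport step).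
[cite: MochizukiGalSect2005, Cor 2.6 p.10] -/
theorem mulNSubgroupTransport_holds : MulNSubgroupTransport X Y α := by
  intro hΔ h65 n H hH
  obtain ⟨hopen, hfi, ⟨Dc, hDc, hDcH⟩, hab⟩ := hH
  refine ⟨?_, ?_, ?_, ?_⟩
  · -- openness: `α` is a homeomorphism
    rw [Subgroup.coe_map]
    exact α.toHomeomorph.isOpenMap _ hopen
  · -- finite index: `α` is bijective
    haveI := hfi
    exact ⟨by
      rw [Subgroup.index_map_of_bijective (f := α.toMulEquiv.toMonoidHom) α.bijective]
      exact Subgroup.FiniteIndex.index_ne_zero⟩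
  · -- (i) a cuspidal decomposition group inside: Thm. 6.5 (iii)
    exact ⟨Dc.map α.toMulEquiv.toMonoidHom, ((h65 α Dc).1 hDc), Subgroup.map_mono hDcH⟩
  · -- (ii) the abelianization condition, transported along `Δ^temp_X ⥲ Δ^temp_Y`
    intro δ
    set δ₀ : X.DeltaTemp := (deltaEquiv α hΔ).symm δ with hδ₀
    have hδ : δ = deltaEquiv α hΔ δ₀ := by rw [hδ₀, MulEquiv.apply_symm_apply]
    have hcoe : (δ : Y.PiTemp) = α (δ₀ : X.PiTemp) := by rw [hδ, coe_deltaEquiv]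
    rw [hcoe]
    constructor
    · intro hmem
      have hx : (δ₀ : X.PiTemp) ∈ H := by
        obtain ⟨x, hx, hxe⟩ := Subgroup.mem_map.1 hmem
        have : x = (δ₀ : X.PiTemp) := α.injective hxe
        rwa [← this]
      have := (hab δ₀).1 hx
      rw [hδ]
      exact (of_mem_range_pow_iff (deltaEquiv α hΔ) n δ₀).1 this
    · intro hpow
      rw [hδ] at hpow
      have hx : (δ₀ : X.PiTemp) ∈ H :=
        (hab δ₀).2 ((of_mem_range_pow_iff (deltaEquiv α hΔ) n δ₀).2 hpow)
      exact Subgroup.mem_map_of_mem _ hx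

end Thm68Sub

end Literature.AnabelianGeometry.SemiGraphs

end
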